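import Mathlib
import Literature.NumberTheory.LFunctions.Zhang2022.TypedSection13Edges
import Literature.NumberTheory.LFunctions.Zhang2022.Section13Eq131a
import Literature.NumberTheory.LFunctions.Zhang2022.Section13ConjugateAFE
import Literature.NumberTheory.LFunctions.Zhang2022.Section13U002
import Literature.NumberTheory.LFunctions.Zhang2022.Section13U003
import Literature.NumberTheory.LFunctions.Zhang2022.Section13U005Repaired
import HarnessLib

/-!
# Zhang (2022) §13 — the kernel-checked CHAIN (13.1) ⇒ (13.2) [⇒ (13.3)] assembled from its leaves

Topic `Literature/NumberTheory/LFunctions/Zhang2022` (Landau–Siegel audit tree; verdict-neutral).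
Y. Zhang, *Discrete mean estimates and the Landau–Siegel zero*, arXiv:2211.02515v1 (2022)
[Zhang2022LandauSiegel], §13 p. 74 — an unrefereed manuscript under adjudication (campaign D-0069).
Theorem-only capstone file: it composes the landed §13 pieces of the cell —

* `Typed.Section13.eq131a_holds` (sz-d40, `Section13Eq131a`, p412581): (13.1) first line, outright;
* `Typed.Section13.eq131b_of_eq131a`, `eq132_of`, `eq133_of` (L3-t6, `TypedSection13Edges`, p413373);
* `Typed.Section13.u001_of` (sz-d40, `Section13ConjugateAFE`, p413411): the "By Lemma 6.1" display
  from Proposition 2.2 (i) and Lemma 6.1;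
* `Typed.Section13.u002_of_prop22i` (sz-d40, `Section13U002`, p413266): the "by Lemma 5.1" display
  from Proposition 2.2 (i) and the tree's exact vertical-shift identity —

into node-level statements: **(13.1) holds (both lines)**, **(13.2) and (13.3) follow from
Proposition 2.2 (i) and Lemma 6.1 alone**, and **the repaired (13.7) follows from Proposition 2.2 (i),
Lemma 6.1 and Lemma 4.8** (three skeleton CLAIM leaves; nothing else of the manuscript is used;
append: `u003_of` of sz-d40's `Section13U003`, `eq137c_of` of sz-d42's `Section13U005Repaired`).
No new definition, no new fact; nothing here asserts Theorems 1–2 or any Siegel-zero statement.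

## References

* Y. Zhang, arXiv:2211.02515v1 (2022), §13 (13.1)–(13.2) p. 74. [cite: Zhang2022LandauSiegel, §13]
-/

noncomputable section

open Complex

namespace Literature.NumberTheory.LFunctions.Zhang2022.Typed.Section13

open Skeleton

/-- **(13.1), second line, HOLDS** (Z22 p.74, tex L3735): from the first line, which holds outright
(`eq131a_holds`, via the exact vertical-shift identities), and the edge `eq131b_of_eq131a` ((2.2) at
`ρ + β₃`, `t₀⁻¹ ≤ 𝓛⁻¹²³`). [cite: Zhang2022LandauSiegel, §13 (13.1), p. 74] -/
theorem eq131b_holds (c' : ℝ) : Eq131b c' := eq131b_of_eq131a (eq131a_holds c')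

variable (c' : ℝ) in
/-- `Eq131b` — `_holds` alias of `eq131b_holds` above under the fact's exact name, stated under the
prover's own binders as section variables (appended 2026-08-28, D-0026 bookkeeping: the proof term is the
existing theorem of this file; no statement, definition or attribute is edited; no new named fact; the
ledger's debt table listed the fact unproved). [cite: Zhang2022LandauSiegel, §13 (13.1), p. 74] -/
theorem _root_.Literature.NumberTheory.LFunctions.Zhang2022.Typed.Section13.Eq131b_holds :
    _root_.Literature.NumberTheory.LFunctions.Zhang2022.Typed.Section13.Eq131b c' :=
  _root_.Literature.NumberTheory.LFunctions.Zhang2022.Typed.Section13.eq131b_holds (c' := c')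

/-- **`Z22:(13.1)` DISCHARGED — both printed equalities of (13.1) hold**, for every value of the
parameter `c′` (no Assumption (A) needed, no skeleton claim used).
[cite: Zhang2022LandauSiegel, §13 (13.1), p. 74] -/
theorem eq131_holds (c' : ℝ) : Eq131 c' := ⟨eq131a_holds c', eq131b_holds c'⟩

variable (c' : ℝ) in
/-- `Eq131` — `_holds` alias of `eq131_holds` above under the fact's exact name, stated under the
prover's own binders as section variables (appended 2026-08-28, D-0026 bookkeeping: the proof term is the
existing theorem of this file; no statement, definition or attribute is edited; no new named fact; the
ledger's debt table listed the fact unproved). [cite: Zhang2022LandauSiegel, §13 (13.1), p. 74] -/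
theorem _root_.Literature.NumberTheory.LFunctions.Zhang2022.Typed.Section13.Eq131_holds :
    _root_.Literature.NumberTheory.LFunctions.Zhang2022.Typed.Section13.Eq131 c' :=
  _root_.Literature.NumberTheory.LFunctions.Zhang2022.Typed.Section13.eq131_holds (c' := c')

/-- **(13.2) from Proposition 2.2 (i) and Lemma 6.1 ALONE** (Z22 p.74, "Hence (13.2)"): composing
`u001_of` (Lemma 6.1 conjugated at `ρ + β₃`), `u002_of_prop22i` (the "by Lemma 5.1" display) and
the edge `eq132_of`; for every `c′` and every `c₀ ≤ c₁`, `c₁ > 0` the constant of Lemma 6.1's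
`ε = exp{−c𝓛¹⁰}`. [cite: Zhang2022LandauSiegel, §13 (13.2), p. 74] -/
theorem eq132_of_prop22i_lemma61 (h22 : Skeleton.Prop22i) (h61 : Skeleton.Lemma61) (c' : ℝ) :
    ∃ c₁ : ℝ, 0 < c₁ ∧ ∀ c₀ : ℝ, c₀ ≤ c₁ → Eq132 c' c₀ := by
  obtain ⟨c₁, hc₁, h1⟩ := u001_of h22 h61 c'
  exact ⟨c₁, hc₁, fun c₀ hc₀ => eq132_of (h1 c₀ hc₀) (u002_of_prop22i h22 c')⟩


/-- **(13.2) and (13.3) from Proposition 2.2 (i) and Lemma 6.1 ALONE** (Z22 p.74: "We insert this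
into (13.2) and then insert the result into (13.1). Thus we obtain (13.3)"): composing sz-d40's
`u001_of`, `u002_of_prop22i`, `u003_of` (`Section13U003`: the display after (13.2) from the tree's
exact vertical-shift identity and Lemma 6.1 conjugated at `ρ + β₂`), `eq131a_holds`, and the edges
`eq132_of`, `eq133_of`; for every `c′` and every `c₀ ≤ c₁`, `c₁ > 0` (the smaller of the two
Lemma-6.1 thresholds). [cite: Zhang2022LandauSiegel, §13 (13.3), p. 74] -/
theorem eq133_of_prop22i_lemma61 (h22 : Skeleton.Prop22i) (h61 : Skeleton.Lemma61) (c' : ℝ) :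
    ∃ c₁ : ℝ, 0 < c₁ ∧ ∀ c₀ : ℝ, c₀ ≤ c₁ → Eq132 c' c₀ ∧ Eq133 c' c₀ := by
  obtain ⟨c₁, hc₁, h1⟩ := u001_of h22 h61 c'
  obtain ⟨c₃, hc₃, h3⟩ := u003_of h22 h61 c'
  refine ⟨min c₁ c₃, lt_min hc₁ hc₃, fun c₀ hc₀ => ?_⟩
  have h132 : Eq132 c' c₀ :=
    eq132_of (h1 c₀ (le_trans hc₀ (min_le_left _ _))) (u002_of_prop22i h22 c')
  exact ⟨h132, eq133_of h22 (eq131a_holds c') h132 (h3 c₀ (le_trans hc₀ (min_le_right _ _)))⟩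

/-- **§13 up to the REPAIRED (13.7), from three skeleton leaves** — Proposition 2.2 (i), Lemma 6.1
and Lemma 4.8: for every `c′` and every `c₀ ≤ c₁`,
`‖Ξ₁₄ + i(Φ₁ + Φ₂ − Φ₃)‖ ≤ C·(𝓔 + 𝓛⁻¹⁰⁰·ΣΣ‖L(ρ+β₁,ψ)N(ρ+β₂,ψ)N(ρ+β₃,ψ)B(ρ,ψ)/L′(ρ,ψ)‖·|ω(ρ)|)`
(the consumer (13.7) with the Lemma-4.8 remainder carried along, GAP-LEDGER G-L3t6-2), by
`eq133_of_prop22i_lemma61` and sz-d42's `eq137c_of` (`Section13U005Repaired`, p412702). The printed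
(13.7) (`Skeleton.Eq137`, second sum absent) and (13.11) (`Skeleton.Eq1311`, not verified in print,
G-L3t6-3) remain CLAIM leaves of `Skeleton.theorem1_of_leaves`. [cite: Zhang2022LandauSiegel, §13 (13.7), p. 75] -/
theorem sec13_repaired_of_leaves (h22 : Skeleton.Prop22i) (h61 : Skeleton.Lemma61)
    (h48 : Skeleton.Lemma48) (c' : ℝ) :
    ∃ c₁ : ℝ, 0 < c₁ ∧ ∀ c₀ : ℝ, c₀ ≤ c₁ → ∃ C : ℝ, ForAllLarge fun D _ χ => AssumptionA D χ →
      ‖xi14 c' χ + I * (Phi1 c' χ + Phi2 c' χ - Phi3 c' χ)‖ ≤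
        C * (frakE c' c₀ χ + (ell D ^ 100)⁻¹ * ∑ i ∈ idx χ,
          ‖i.1.ψ.LFunction (i.2 + beta1 c' D) * Nchar D (psiFn i.1) (i.2 + beta2 c' D) *
              Nchar D (psiFn i.1) (i.2 + beta3 c' D) * Bpoly χ i.1 i.2 /
              deriv i.1.ψ.LFunction i.2‖ * ‖omegaW D i.2‖) := by
  obtain ⟨c₁, hc₁, h⟩ := eq133_of_prop22i_lemma61 h22 h61 c'
  exact ⟨c₁, hc₁, fun c₀ hc₀ => eq137c_of c' c₀ (h c₀ hc₀).2 h48 h22⟩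

end Literature.NumberTheory.LFunctions.Zhang2022.Typed.Section13
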